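import Literature.MathematicalPhysics.QuantumFieldTheory.Balaban1983to89.HiggsLattice

/-!
# `Balaban1983to89.HiggsRescaling` — T. Bałaban, *(Higgs)₂,₃ quantum fields in a finite volume. I. A lower bound*,
Commun. Math. Phys. **85** (1982) 603–626 [Balaban1982Higgs1], p. 607: the partitions into LARGE blocks (`L` replaced
by `ML`) and the canonical RESCALINGS (1.22)–(1.23) of lattices, fields and constants, as CONCRETE definitions over the
carrier `…Balaban1983to89.HiggsLattice`

statement-level skeleton of published theorems with citation tags; proofs where landed; nothing here is a claim about the Yang–Mills mass gap

PDF held: `paper:balaban1982-cmp85-higgs23-i` (journal page = PDF page + 602).  Displays read from the ×2 render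
`run/shared/lean/pub/pub-balaban/b2b-balaban-ref1/pages/1982-cmp85-higgs23-I/1982-cmp85-higgs23-I-p005-x2.png` (p. 607).

CITATION HEADER (lean-in-tree rule).  Fourth CARRIER module of the lit-balaban typed skeleton for the (Higgs)₂,₃ papers
B1–B3 (HOME `run/shared/lean/pub/lit-balaban/`, SHARED-STRUCTURES.md §3); it supplies the objects of the SKELETON
definition rows B1.Eq1.16 (large-block part) and B1.Eq1.22 (reader r01/r14, `lit-balaban-r01/ROWS-B1.md`).  WHAT IS
REPRODUCED, as definitions with bodies (no statement of the paper is asserted; the one theorem is the printed one-line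
computation (1.23)): p. 607 *"Further we will use the partitions into large blocks besides the partitions into blocks
described above. They are defined in the same way, only L is replaced by ML, where M is a sufficiently large natural
number."* (`LargeBlock`, `largeBlockOf`, `largeBlock`); p. 607 *"We use only the canonical rescalings, so we have
φ(x) = (η/δ)^{−(d−2)/2} φ'((δ/η)x), x ∈ ηℤ^d … (1.22) and the same formulas for vector fields"* (`Params.scaleBy` —
the `δ = sη` lattice on the same sites —, `rescaleScalar`, `rescaleVec`), (1.23)
`(∂^η_μ φ)(x) = (η/δ)^{−d/2} (∂^δ_μ φ')((δ/η)x)` (PROVED: `sderiv_rescaleScalar`), and the rescaling of the constants of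
(1.11) *"ε replaced by sε, T_ε by T_{sε}, the constants m₀², μ₀² are replaced by m₀²s⁻², μ₀²s⁻², and the coupling constants
e, λ are replaced by λ_s = λs^{−(4−d)}, e_s = es^{−(4−d)/2}"* (`Couplings.scaleBy`, `ChargeData.scaleBy`).  DELIBERATELY
NOT HERE (reader-owned rows): the invariance of the action (1.11) under the rescaling (p. 607, *"we get the action again
of the form (1.11)"*) and the convention `λ_s = 1`; (1.24).  CONVENTIONS: as in `…HiggsLattice`; a rescaling by the
factor `s > 0` keeps the combinatorial tori `Site P k` (labels) and multiplies every spacing by `s` (`mesh_scaleBy`), so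
the map `x ↦ (δ/η)x` of (1.22) is the identity on labels.  Unit `lit-balaban-typer` (literature-prover-lit-balaban-typer-0);
HOME/FILED.md records the proposal.
v1.1 (append-only, typer gen 2 literature-prover-lit-balaban-typer-g2-0; no v1 declaration changed): §5 — the p. 607
claim on how (1.11) rescales (*"we get the action again of the form (1.11), but with ε replaced by sε, …, m₀²s⁻², μ₀²s⁻²,
… λ_s = λs^{−(4−d)}, e_s = es^{−(4−d)/2}"*), listed above as not here, is NOW PROVED: `action_rescale` (and
`actionPrime_rescale` for (1.8)), with the termwise lemmas `U_rescale`, `covDeriv_rescale`, `covLaplaceForm_rescale`,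
`potential_rescale`, `vecLaplaceForm_rescale`, `massTerm_rescale`, `curl_rescale` — the rescaling step of I (3.7)
p. 613 (`s = ε⁻¹`) and II (2.1) p. 556.
v1.2 (append-only, typer gen 2; no earlier declaration changed): §6 — the Lebesgue measure of p. 605 under the change of
variables (1.22) (`integral_comp_rescale`: bond relabeling is measure preserving, the homothety `σ = s^{(d−2)/2}` scales
the measure; Mathlib `volume_measurePreserving_piCongrLeft`, `Measure.integral_comp_smul`) and the resulting rescaling of
the partition function (1.10), `partitionFn_rescale`: `Z^{sε}(e_s, λ_s, m₀²s⁻², μ₀²s⁻²) = σ^{−(|bonds|+N|sites|)} Z^ε(e, λ, m₀², μ₀²)`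
— the *"constant factors"* of II (2.1) / *"const"* of I (3.7). PROVED.
-/

open scoped BigOperators
open _root_.MeasureTheory

namespace Literature.MathematicalPhysics.QuantumFieldTheory.Balaban1983to89.HiggsRescaling

open Literature.MathematicalPhysics.QuantumFieldTheory.Balaban1983to89.HiggsLattice

variable {P : Params}

/-! ## 1. Large blocks (p. 607) -/

/-- Index set of the LARGE blocks of `T^{(k)}` (p. 607: blocks *"defined in the same way, only L is replaced by ML"*):
per direction `2L^{K−k}ML'_μ / (LM) = 2L^{K−k−1}L'_μ` large blocks (meaningful for `k < K`; p. 607: *"The sets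
T^{(k)}_{L^kε} are the sums of large blocks also"*). [cite: Balaban1982Higgs1, (1.21) p.607] -/
def LargeBlock (P : Params) (k : ℕ) : Type := (μ : Fin P.d) → ZMod (2 * (P.L ^ (P.K - k - 1) * P.Lp μ))

namespace LargeBlock

variable {k : ℕ}

/-- The large-block counts are positive (`L, L'_μ` positive integers, (1.2) p. 604). [cite: Balaban1982Higgs1, (1.2) p.604] -/
theorem count_pos (P : Params) (k : ℕ) (μ : Fin P.d) : 0 < 2 * (P.L ^ (P.K - k - 1) * P.Lp μ) := by
  have h1 : 0 < P.L ^ (P.K - k - 1) := pow_pos P.hL _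
  have h2 := P.hLp μ
  positivity

/-- `NeZero` instance for the large-block counts. [folklore] -/
instance (P : Params) (k : ℕ) (μ : Fin P.d) : NeZero (2 * (P.L ^ (P.K - k - 1) * P.Lp μ)) :=
  ⟨(count_pos P k μ).ne'⟩

/-- Large-block indices form a finite type. [folklore] -/
instance : Fintype (LargeBlock P k) :=
  inferInstanceAs (Fintype ((μ : Fin P.d) → ZMod (2 * (P.L ^ (P.K - k - 1) * P.Lp μ))))

/-- Decidable equality of large-block indices. [folklore] -/
instance : DecidableEq (LargeBlock P k) :=
  inferInstanceAs (DecidableEq ((μ : Fin P.d) → ZMod (2 * (P.L ^ (P.K - k - 1) * P.Lp μ))))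

end LargeBlock

/-- The large block containing a site of `T^{(k)}`: blocks of side `MLη` anchored at the points of `MLηℤ^d` (p. 607, with
(1.17): `y_μ ≤ x_μ < y_μ + MLη`); in labels, integer division by `L·M`. [cite: Balaban1982Higgs1, (1.17) p.606] -/
def largeBlockOf {k : ℕ} (x : Site P k) : LargeBlock P k :=
  fun μ => (((x μ).val / (P.L * P.M) : ℕ) : ZMod (2 * (P.L ^ (P.K - k - 1) * P.Lp μ)))

/-- The large block with a given index, as a `Finset` of sites of `T^{(k)}` (p. 607). [cite: Balaban1982Higgs1, (1.17) p.606] -/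
def largeBlock {k : ℕ} (z : LargeBlock P k) : Finset (Site P k) := Finset.univ.filter fun x => largeBlockOf x = z

/-- A finite set of sites is a SUM OF LARGE BLOCKS (p. 607; the standing shape hypothesis *"Ω^{(k)} ⊂ T^{(k)} be a sum of big
blocks"* of Prop. 2.1 p. 610). [cite: Balaban1982Higgs1, Prop 2.1 p.610] -/
def IsUnionOfLargeBlocks {k : ℕ} (Ω : Finset (Site P k)) : Prop :=
  ∀ x ∈ Ω, ∀ x' : Site P k, largeBlockOf x' = largeBlockOf x → x' ∈ Ω

/-! ## 2. Rescaling of the lattice spacing (p. 607) -/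

/-- The rescaled parameters: *"If we rescale (1.11) from the ε-lattice to an sε-lattice, … ε replaced by sε, T_ε by
T_{sε}"* (p. 607) — the same combinatorial tori with every spacing multiplied by `s > 0`. [cite: Balaban1982Higgs1, (1.22) p.607] -/
noncomputable def _root_.Literature.MathematicalPhysics.QuantumFieldTheory.Balaban1983to89.HiggsLattice.Params.scaleBy
    (P : Params) (s : ℝ) (hs : 0 < s) : Params :=
  { P with ε := s * P.ε, hε := mul_pos hs P.hε }

/-- The spacings of the rescaled family: `mesh_k(sε) = s · mesh_k(ε)`. [cite: Balaban1982Higgs1, (1.22) p.607] -/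
theorem mesh_scaleBy (P : Params) {s : ℝ} (hs : 0 < s) (k : ℕ) : (P.scaleBy s hs).mesh k = s * P.mesh k := by
  simp [Params.scaleBy, Params.mesh]
  ring

/-! ## 3. The canonical rescalings of fields (1.22) and of derivatives (1.23) -/

section Fields

variable {k N : ℕ} {s : ℝ}

/-- **(1.22)** p. 607 for scalar fields: from `φ'` on the `δ = sη` lattice to `φ` on the `η` lattice,
`φ(x) = (η/δ)^{−(d−2)/2} φ'((δ/η)x) = s^{(d−2)/2} φ'(x)` (same label `x`; `η/δ = s⁻¹`). [cite: Balaban1982Higgs1, (1.22) p.607] -/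
noncomputable def rescaleScalar (hs : 0 < s) (φ' : ScalarField (P.scaleBy s hs) k N) : ScalarField P k N :=
  fun x => (s ^ (((P.d : ℝ) - 2) / 2)) • φ' x

/-- **(1.22)** p. 607 for vector fields (*"and the same formulas for vector fields"*):
`A(b) = s^{(d−2)/2} A'(b)`. [cite: Balaban1982Higgs1, (1.22) p.607] -/
noncomputable def rescaleVec (hs : 0 < s) (A' : VecField (P.scaleBy s hs) k) : VecField P k :=
  fun b => s ^ (((P.d : ℝ) - 2) / 2) * A' ⟨b.src, b.dir⟩

/-- **(1.23)** p. 607: `(∂^η_μ φ)(x) = (η/δ)^{−d/2} (∂^δ_μ φ')((δ/η)x)`, i.e. `∂^η(rescale φ') = s^{d/2} · ∂^δ φ'`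
(the factor `s^{(d−2)/2}` of (1.22) times `δ/η = s` from the difference quotient).  PROVED. [cite: Balaban1982Higgs1, (1.23) p.607] -/
theorem sderiv_rescaleScalar (hs : 0 < s) (φ' : ScalarField (P.scaleBy s hs) k N) (b : PBond P k) :
    sderiv (rescaleScalar hs φ') b
      = (s ^ ((P.d : ℝ) / 2)) • sderiv (P := P.scaleBy s hs) φ' ⟨b.src, b.dir⟩ := by
  have hmesh : (P.scaleBy s hs).mesh k = s * P.mesh k := mesh_scaleBy P hs k
  have hη : P.mesh k ≠ 0 := (P.mesh_pos k).ne'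
  have hpow : s ^ ((P.d : ℝ) / 2) = s ^ (((P.d : ℝ) - 2) / 2) * s := by
    rw [← Real.rpow_add_one hs.ne']
    congr 1
    ring
  simp only [sderiv, rescaleScalar, hmesh, ← smul_sub, smul_smul, hpow]
  congr 1
  field_simp

end Fields

/-! ## 4. Rescaling of the constants of the action (1.11) (p. 607) -/

/-- p. 607: under `ε ↦ sε` *"the constants m₀², μ₀² are replaced by m₀²s⁻², μ₀²s⁻², and the coupling constants e, λ
are replaced by λ_s = λs^{−(4−d)}, e_s = es^{−(4−d)/2}"* — the couplings part (`E` unchanged). [cite: Balaban1982Higgs1, (1.23) p.607] -/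
noncomputable def _root_.Literature.MathematicalPhysics.QuantumFieldTheory.Balaban1983to89.HiggsLattice.Couplings.scaleBy
    (c : Couplings) (d : ℕ) (s : ℝ) : Couplings where
  m0sq := c.m0sq * s⁻¹ ^ 2
  lam := c.lam * s ^ (-(4 - (d : ℝ)))
  mu0sq := c.mu0sq * s⁻¹ ^ 2
  E := c.E

/-- p. 607: the charge is replaced by `e_s = e s^{−(4−d)/2}` (`q` unchanged). [cite: Balaban1982Higgs1, (1.23) p.607] -/
noncomputable def _root_.Literature.MathematicalPhysics.QuantumFieldTheory.Balaban1983to89.HiggsLattice.ChargeData.scaleBy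
    {N : ℕ} (C : ChargeData N) (d : ℕ) (s : ℝ) : ChargeData N :=
  { C with e := C.e * s ^ (-(4 - (d : ℝ)) / 2) }

/-- p. 607: *"It is convenient to rescale in such a way that λ_s = 1, so s = λ^{1/(4−d)} and then e_s = eλ^{−1/2}"* — the
scale factor `s = λ^{1/(4−d)}` (for `d < 4`). [cite: Balaban1982Higgs1, (1.23) p.607] -/
noncomputable def unitLambdaScale (lam : ℝ) (d : ℕ) : ℝ := lam ^ (1 / (4 - (d : ℝ)))

/-- With `s = λ^{1/(4−d)}` the rescaled quartic coupling is `λ_s = 1` (`λ > 0`, `d < 4`). PROVED. [cite: Balaban1982Higgs1, (1.23) p.607] -/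
theorem lam_scaleBy_unitLambdaScale (c : Couplings) {d : ℕ} (hd : d < 4) (hlam : 0 < c.lam) :
    (c.scaleBy d (unitLambdaScale c.lam d)).lam = 1 := by
  have h4 : (4 : ℝ) - (d : ℝ) ≠ 0 := by
    have : (d : ℝ) < 4 := by exact_mod_cast hd
    linarith
  have hexp : 1 / (4 - (d : ℝ)) * (-(4 - (d : ℝ))) = -1 := by
    rw [one_div, inv_mul_eq_div, neg_div, div_self h4]
  simp only [Couplings.scaleBy, unitLambdaScale]
  rw [← Real.rpow_mul hlam.le, hexp, Real.rpow_neg_one, mul_inv_cancel₀ hlam.ne']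


/-! ## 5. v1.1 (append-only, typer gen 2): the RESCALING OF THE ACTION (1.11) — the p. 607 claim PROVED

p. 607, verbatim: *"Finally, it is very important to know how the constants in the action (1.11) are changed after a
rescaling. If we rescale (1.11) from the ε-lattice to an sε-lattice, then from (1.22), (1.23) it follows that we get the
action again of the form (1.11), but with ε replaced by sε, T_ε by T_{sε}, the constants m₀², μ₀² are replaced by
m₀²s⁻², μ₀²s⁻², and the coupling constants e, λ are replaced by λ_s = λs^{−(4−d)}, e_s = es^{−(4−d)/2}."*  With the
§3 field rescalings `rescaleScalar`/`rescaleVec` ((1.22): `φ = s^{(d−2)/2} φ'` on the same labels) and the §4 constant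
rescalings `Couplings.scaleBy`/`ChargeData.scaleBy` this is the identity `action_rescale` below
(`S^ε_{e,λ,m₀,μ₀}(A, φ) = S^{sε}_{e_s,λ_s,m₀/s,μ₀/s}(A', φ')`), proved term by term; the same computation for (1.8) is
`actionPrime_rescale`.  No v1 declaration is changed. -/

section ActionRescaling

variable {k N : ℕ} {s : ℝ}

/-- Sums over the bonds of the `sε`-lattice are sums over the bonds of the `ε`-lattice (same combinatorial torus;
(1.22) p. 607: the map `x ↦ (δ/η)x` is the identity on labels — the two bond types differ only in the parameter
record, relabeling `b ↦ ⟨b₋, μ⟩`). [folklore] -/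
private theorem sum_bond_rescale (hs : 0 < s) (f : PBond (P.scaleBy s hs) k → ℝ) :
    ∑ b : PBond (P.scaleBy s hs) k, f b = ∑ b : PBond P k, f ⟨b.src, b.dir⟩ :=
  (Fintype.sum_equiv (⟨fun b => ⟨b.src, b.dir⟩, fun b => ⟨b.src, b.dir⟩, fun _ => rfl, fun _ => rfl⟩ :
    PBond P k ≃ PBond (P.scaleBy s hs) k) _ _ fun _ => rfl).symm

/-- The same relabeling for sums over plaquettes. [folklore] -/
private theorem sum_plaq_rescale (hs : 0 < s) (f : Plaq (P.scaleBy s hs) k → ℝ) :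
    ∑ p : Plaq (P.scaleBy s hs) k, f p = ∑ p : Plaq P k, f ⟨p.src, p.μ, p.ν, p.hμν⟩ :=
  (Fintype.sum_equiv (⟨fun p => ⟨p.src, p.μ, p.ν, p.hμν⟩, fun p => ⟨p.src, p.μ, p.ν, p.hμν⟩, fun _ => rfl,
    fun _ => rfl⟩ : Plaq P k ≃ Plaq (P.scaleBy s hs) k) _ _ fun _ => rfl).symm

/-- The rescaled family has the same dimension (only `ε` changes; definitional). [cite: Balaban1982Higgs1, (1.22) p.607] -/
theorem scaleBy_d (P : Params) (hs : 0 < s) : (P.scaleBy s hs).d = P.d := rfl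

/-- Exponent bookkeeping: `(s^{(d−2)/2})² = s^d · s⁻²`. [folklore] -/
private theorem sig_sq (hs : 0 < s) (d : ℕ) :
    (s ^ (((d : ℝ) - 2) / 2)) ^ 2 = s ^ d * (s⁻¹) ^ 2 := by
  rw [← Real.rpow_natCast (s ^ (((d : ℝ) - 2) / 2)) 2, ← Real.rpow_mul hs.le, inv_pow, ← Real.rpow_natCast s d,
    ← Real.rpow_natCast s 2, ← Real.rpow_neg hs.le, ← Real.rpow_add hs]
  congr 1
  push_cast
  ring

/-- Exponent bookkeeping: `(s^{(d−2)/2})⁴ = s^d · s^{−(4−d)}`. [folklore] -/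
private theorem sig_pow_four (hs : 0 < s) (d : ℕ) :
    (s ^ (((d : ℝ) - 2) / 2)) ^ 4 = s ^ d * s ^ (-(4 - (d : ℝ))) := by
  rw [← Real.rpow_natCast (s ^ (((d : ℝ) - 2) / 2)) 4, ← Real.rpow_mul hs.le, ← Real.rpow_natCast s d,
    ← Real.rpow_add hs]
  congr 1
  push_cast
  ring

/-- Exponent bookkeeping: `(s^{(d−2)/2} · s)² = s^d`. [folklore] -/
private theorem sig_mul_sq (hs : 0 < s) (d : ℕ) :
    (s ^ (((d : ℝ) - 2) / 2) * s) ^ 2 = s ^ d := by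
  rw [mul_pow, sig_sq hs d, inv_pow, mul_assoc, inv_mul_cancel₀ (pow_ne_zero 2 hs.ne'), mul_one]

/-- Exponent bookkeeping: `s^{(d−2)/2} = s · s^{−(4−d)/2}` (the charge rescaling `e_s = es^{−(4−d)/2}` absorbs the
field factor up to one power of `s`). [folklore] -/
private theorem sig_eq_mul (hs : 0 < s) (d : ℕ) :
    s ^ (((d : ℝ) - 2) / 2) = s * s ^ (-(4 - (d : ℝ)) / 2) := by
  conv_rhs => rw [← Real.rpow_one s, ← Real.rpow_mul hs.le, one_mul, ← Real.rpow_add hs]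
  congr 1
  ring

/-- p. 607 with p. 605: the representation on the `ε`-lattice at charge `e` and rescaled bond variable
`s^{(d−2)/2}A'` IS the representation on the `sε`-lattice at the rescaled charge `e_s = es^{−(4−d)/2}` and `A'`
(`ε·e·s^{(d−2)/2}A' = (sε)·e_s·A'`) — the vector-field part of *"e replaced by e_s"*. PROVED. [cite: Balaban1982Higgs1, (1.23) p.607] -/
theorem U_rescale (hs : 0 < s) (C : ChargeData N) (k : ℕ) (A' : ℝ) :
    C.U (P.mesh k) (s ^ (((P.d : ℝ) - 2) / 2) * A') = (C.scaleBy P.d s).U ((P.scaleBy s hs).mesh k) A' := by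
  unfold ChargeData.U
  simp only [ChargeData.scaleBy, mesh_scaleBy P hs k]
  congr 2
  rw [sig_eq_mul hs P.d]
  ring

/-- (1.22)–(1.23) p. 607 for the covariant derivative (1.7): `D^ε_{A} φ = s^{(d−2)/2}·s · D^{sε}_{A'} φ'` at the
rescaled charge (the factor `(η/δ)^{−d/2} = s^{d/2}` of (1.23), written as `s^{(d−2)/2}·s`). PROVED. [cite: Balaban1982Higgs1, (1.23) p.607] -/
theorem covDeriv_rescale (hs : 0 < s) (C : ChargeData N) (A' : VecField (P.scaleBy s hs) k)
    (φ' : ScalarField (P.scaleBy s hs) k N) (b : PBond P k) :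
    covDeriv C (rescaleVec hs A') (rescaleScalar hs φ') b
      = (s ^ (((P.d : ℝ) - 2) / 2) * s) •
          covDeriv (P := P.scaleBy s hs) (C.scaleBy P.d s) A' φ' ⟨b.src, b.dir⟩ := by
  have hη : P.mesh k ≠ 0 := (P.mesh_pos k).ne'
  simp only [covDeriv, rescaleVec, rescaleScalar, U_rescale hs C k, mesh_scaleBy P hs k, map_smul, ← smul_sub,
    smul_smul]
  congr 1
  field_simp

/-- (1.22)–(1.23) p. 607 for the quadratic form of the covariant Laplacian in (1.11):
`⟨φ,(−Δ^ε_A)φ⟩_{T_ε} = ⟨φ',(−Δ^{sε}_{A'})φ'⟩_{T_{sε}}` at `e_s`. PROVED. [cite: Balaban1982Higgs1, (1.23) p.607] -/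
theorem covLaplaceForm_rescale (hs : 0 < s) (C : ChargeData N) (A' : VecField (P.scaleBy s hs) k)
    (φ' : ScalarField (P.scaleBy s hs) k N) :
    covLaplaceForm C (rescaleVec hs A') (rescaleScalar hs φ')
      = covLaplaceForm (P := P.scaleBy s hs) (C.scaleBy P.d s) A' φ' := by
  unfold covLaplaceForm
  rw [sum_bond_rescale hs]
  refine Finset.sum_congr rfl fun b _ => ?_
  rw [covDeriv_rescale hs C A' φ' b, norm_smul, mul_pow, Real.norm_of_nonneg (by positivity), sig_mul_sq hs P.d,
    mesh_scaleBy P hs k, mul_pow, scaleBy_d]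
  ring

/-- (1.22) p. 607 for the scalar self-interaction of (1.8)/(1.11): *"m₀² … replaced by m₀²s⁻² … λ replaced by
λ_s = λs^{−(4−d)}"*. PROVED. [cite: Balaban1982Higgs1, (1.23) p.607] -/
theorem potential_rescale (hs : 0 < s) (c : Couplings) (φ' : ScalarField (P.scaleBy s hs) k N) :
    potential c (rescaleScalar hs φ') = potential (P := P.scaleBy s hs) (c.scaleBy P.d s) φ' := by
  unfold potential
  refine Finset.sum_congr rfl fun x _ => ?_
  simp only [rescaleScalar, norm_smul, Real.norm_of_nonneg (Real.rpow_nonneg hs.le _), Couplings.scaleBy,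
    mesh_scaleBy P hs k, mul_pow, sig_sq hs P.d, sig_pow_four hs P.d, scaleBy_d]
  ring

/-- The components `A_μ` of a rescaled vector field: `(rescaleVec A')_μ = s^{(d−2)/2} A'_μ` ((1.22) *"the same
formulas for vector fields"*). [cite: Balaban1982Higgs1, (1.22) p.607] -/
theorem comp_rescaleVec (hs : 0 < s) (A' : VecField (P.scaleBy s hs) k) (μ : Fin P.d) (x : Site P k) :
    (rescaleVec hs A').comp μ x = s ^ (((P.d : ℝ) - 2) / 2) * A'.comp μ x := rfl

/-- (1.23) p. 607 for real-valued site functions (the components `A_μ`): `∂^ε(s^{(d−2)/2} f) = s^{(d−2)/2}·s · ∂^{sε} f`.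
PROVED. [cite: Balaban1982Higgs1, (1.23) p.607] -/
theorem sderiv_rescale_real (hs : 0 < s) (f : Site (P.scaleBy s hs) k → ℝ) (b : PBond P k) :
    sderiv (P := P) (fun x : Site P k => s ^ (((P.d : ℝ) - 2) / 2) * f x) b
      = (s ^ (((P.d : ℝ) - 2) / 2) * s) * sderiv (P := P.scaleBy s hs) f ⟨b.src, b.dir⟩ := by
  have hη : P.mesh k ≠ 0 := (P.mesh_pos k).ne'
  simp only [sderiv, smul_eq_mul, mesh_scaleBy P hs k, ← mul_sub]
  field_simp
  rfl

/-- (1.22)–(1.23) p. 607 for the Feynman-gauge kinetic term of (1.11): `⟨A,(−Δ^ε)A⟩_{T_ε} = ⟨A',(−Δ^{sε})A'⟩_{T_{sε}}`.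
PROVED. [cite: Balaban1982Higgs1, (1.23) p.607] -/
theorem vecLaplaceForm_rescale (hs : 0 < s) (A' : VecField (P.scaleBy s hs) k) :
    vecLaplaceForm (rescaleVec hs A') = vecLaplaceForm (P := P.scaleBy s hs) A' := by
  unfold vecLaplaceForm
  refine Finset.sum_congr rfl fun μ _ => ?_
  rw [sum_bond_rescale hs]
  refine Finset.sum_congr rfl fun b _ => ?_
  have hc : (rescaleVec hs A').comp μ = fun x : Site P k => s ^ (((P.d : ℝ) - 2) / 2) * A'.comp μ x := rfl
  rw [hc, sderiv_rescale_real hs (A'.comp μ) b, mul_pow, sig_mul_sq hs P.d, mesh_scaleBy P hs k, mul_pow, scaleBy_d]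
  ring

/-- (1.22) p. 607 for the vector-field mass term of (1.8)/(1.11): *"μ₀² … replaced by μ₀²s⁻²"*. PROVED. [cite: Balaban1982Higgs1, (1.23) p.607] -/
theorem massTerm_rescale (hs : 0 < s) (c : Couplings) (A' : VecField (P.scaleBy s hs) k) :
    ∑ b : PBond P k, P.mesh k ^ P.d * (c.mu0sq * (rescaleVec hs A' b) ^ 2)
      = ∑ b : PBond (P.scaleBy s hs) k,
          (P.scaleBy s hs).mesh k ^ P.d * ((c.scaleBy P.d s).mu0sq * (A' b) ^ 2) := by
  rw [sum_bond_rescale hs]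
  refine Finset.sum_congr rfl fun b _ => ?_
  simp only [rescaleVec, Couplings.scaleBy, mesh_scaleBy P hs k, mul_pow, sig_sq hs P.d]
  ring

/-- (1.22)–(1.23) p. 607 for the plaquette derivative (1.6): `(∂^ε A)(P) = s^{(d−2)/2}·s · (∂^{sε} A')(P)`. PROVED. [cite: Balaban1982Higgs1, (1.23) p.607] -/
theorem curl_rescale (hs : 0 < s) (A' : VecField (P.scaleBy s hs) k) (p : Plaq P k) :
    curl (rescaleVec hs A') p
      = (s ^ (((P.d : ℝ) - 2) / 2) * s) * curl (P := P.scaleBy s hs) A' ⟨p.src, p.μ, p.ν, p.hμν⟩ := by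
  have hη : P.mesh k ≠ 0 := (P.mesh_pos k).ne'
  simp only [curl, rescaleVec, mesh_scaleBy P hs k]
  field_simp
  rfl

/-- **p. 607, the rescaling of the action (1.11)**, verbatim: *"If we rescale (1.11) from the ε-lattice to an
sε-lattice, then from (1.22), (1.23) it follows that we get the action again of the form (1.11), but with ε replaced by
sε, T_ε by T_{sε}, the constants m₀², μ₀² are replaced by m₀²s⁻², μ₀²s⁻², and the coupling constants e, λ are replaced
by λ_s = λs^{−(4−d)}, e_s = es^{−(4−d)/2}."* — typed reading: for fields `A', φ'` on the `sε`-lattice and their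
canonical rescalings `A = rescaleVec A'`, `φ = rescaleScalar φ'` (1.22) on the `ε`-lattice,
`S^ε_{e,λ,m₀²,μ₀²,E}(A, φ) = S^{sε}_{e_s,λ_s,m₀²s⁻²,μ₀²s⁻²,E}(A', φ')` (`E` unchanged). PROVED (term by term:
`covLaplaceForm_rescale`, `potential_rescale`, `vecLaplaceForm_rescale`, `massTerm_rescale`).  This is the step
*"This integral is rescaled from the ε-lattice to the unit lattice … with η = ε, δ = 1"* of p. 613 before (3.7)
(`s = ε⁻¹`) and of II (2.1) p. 556. [cite: Balaban1982Higgs1, (1.23) p.607] -/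
theorem action_rescale (hs : 0 < s) (C : ChargeData N) (c : Couplings) (A' : VecField (P.scaleBy s hs) k)
    (φ' : ScalarField (P.scaleBy s hs) k N) :
    action C c (rescaleVec hs A') (rescaleScalar hs φ')
      = action (P := P.scaleBy s hs) (C.scaleBy P.d s) (c.scaleBy P.d s) A' φ' := by
  unfold action
  rw [covLaplaceForm_rescale hs C A' φ', potential_rescale hs c φ', vecLaplaceForm_rescale hs A',
    massTerm_rescale hs c A']
  rfl

/-- The same rescaling for the action (1.8) (plaquette kinetic term `½Σ_P ε^d |(∂^εA)(P)|²` in place of the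
Feynman-gauge form; no constant `E`): `S'^ε_{e,λ,m₀²,μ₀²}(A, φ) = S'^{sε}_{e_s,λ_s,m₀²s⁻²,μ₀²s⁻²}(A', φ')`. PROVED. [cite: Balaban1982Higgs1, (1.8) p.605] -/
theorem actionPrime_rescale (hs : 0 < s) (C : ChargeData N) (c : Couplings) (A' : VecField (P.scaleBy s hs) k)
    (φ' : ScalarField (P.scaleBy s hs) k N) :
    actionPrime C c (rescaleVec hs A') (rescaleScalar hs φ')
      = actionPrime (P := P.scaleBy s hs) (C.scaleBy P.d s) (c.scaleBy P.d s) A' φ' := by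
  unfold actionPrime
  have hcurl : ∑ p : Plaq P k, P.mesh k ^ P.d * (curl (rescaleVec hs A') p) ^ 2
      = ∑ p : Plaq (P.scaleBy s hs) k, (P.scaleBy s hs).mesh k ^ P.d * (curl (P := P.scaleBy s hs) A' p) ^ 2 := by
    rw [sum_plaq_rescale hs]
    refine Finset.sum_congr rfl fun p _ => ?_
    rw [curl_rescale hs A' p, mul_pow, sig_mul_sq hs P.d, mesh_scaleBy P hs k, mul_pow]
    ring
  rw [covLaplaceForm_rescale hs C A' φ', potential_rescale hs c φ', hcurl, massTerm_rescale hs c A']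
  rfl

end ActionRescaling

/-! ## 6. v1.2 (append-only, typer gen 2): Lebesgue measure under the rescaling (1.22) — the partition function (1.10)
rescales by the Jacobian of `(A', φ') ↦ (A, φ)`

p. 605 fixes *"the natural Lebesgue measure … on the spaces of configurations of scalar and vector fields"* and p. 607
rescales the action; the integral `Z^ε = ∫dA∫dφ exp(−S^ε)` (1.10) then rescales by the Jacobian of the linear change of
variables (1.22): `(A, φ) = (σA', σφ')`, `σ = s^{(d−2)/2}`, on the same labels.  This is the bookkeeping behind the
*"const"* of (3.7) p. 613 and II (2.1) p. 556 (*"Omitting the constant factors"*). -/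

section Jacobian

variable {k N : ℕ} {s : ℝ}

/-- The change of variables (1.22) in the Lebesgue integral over (vector field, scalar field) pairs of `T^{(k)}`:
`∫ F(σ·relabel A', σφ') d(A',φ') = σ^{−(|bonds| + N·|sites|)} ∫ F(A, φ) d(A,φ)`, `σ = s^{(d−2)/2}` — the relabeling of
the bonds between the two parameter records is measure preserving (`MeasureTheory.volume_measurePreserving_piCongrLeft`,
product with the identity on scalar fields) and the homothety scales Lebesgue measure by `σ^{−dim}`
(`MeasureTheory.Measure.integral_comp_smul`).  No integrability is needed (Bochner integrals on both sides). PROVED. [cite: Balaban1982Higgs1, (1.22) p.607] -/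
theorem integral_comp_rescale (hs : 0 < s) (F : VecField P k × ScalarField P k N → ℝ) :
    ∫ Φ' : VecField (P.scaleBy s hs) k × ScalarField (P.scaleBy s hs) k N,
        F (rescaleVec hs Φ'.1, rescaleScalar hs Φ'.2)
      = |((s ^ (((P.d : ℝ) - 2) / 2)) ^ (Fintype.card (PBond P k) + N * Fintype.card (Site P k)))⁻¹|
          * ∫ Φ : VecField P k × ScalarField P k N, F Φ := by
  set e : PBond (P.scaleBy s hs) k ≃ PBond P k :=
    ⟨fun b => ⟨b.src, b.dir⟩, fun b => ⟨b.src, b.dir⟩, fun _ => rfl, fun _ => rfl⟩ with he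
  set Φb := MeasurableEquiv.piCongrLeft (fun _ : PBond P k => ℝ) e with hΦb
  have hmp : MeasurePreserving Φb volume volume := volume_measurePreserving_piCongrLeft (fun _ : PBond P k => ℝ) e
  have hΦapp : ∀ (g : VecField (P.scaleBy s hs) k) (b : PBond (P.scaleBy s hs) k), Φb g (e b) = g b := by
    intro g b
    rw [hΦb, MeasurableEquiv.coe_piCongrLeft, Equiv.piCongrLeft_apply_apply]
  set Ψ : (VecField (P.scaleBy s hs) k × ScalarField (P.scaleBy s hs) k N) ≃ᵐ (VecField P k × ScalarField P k N) :=
    MeasurableEquiv.prodCongr Φb (MeasurableEquiv.refl (ScalarField P k N)) with hΨ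
  have hΨapp : ∀ Φ' : VecField (P.scaleBy s hs) k × ScalarField (P.scaleBy s hs) k N, Ψ Φ' = (Φb Φ'.1, Φ'.2) :=
    fun _ => rfl
  have hΨmp : MeasurePreserving Ψ volume volume := by
    have h := hmp.prod (MeasurePreserving.id (volume : Measure (ScalarField P k N)))
    rw [← Measure.volume_eq_prod, ← Measure.volume_eq_prod] at h
    refine ⟨Ψ.measurable, ?_⟩
    have hcoe : (Ψ : VecField (P.scaleBy s hs) k × ScalarField (P.scaleBy s hs) k N
        → VecField P k × ScalarField P k N) = Prod.map Φb id := by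
      funext Φ'
      rw [hΨapp]
      rfl
    rw [hcoe]
    exact h.map_eq
  have hR : ∀ Φ' : VecField (P.scaleBy s hs) k × ScalarField (P.scaleBy s hs) k N,
      (rescaleVec hs Φ'.1, rescaleScalar hs Φ'.2) = s ^ (((P.d : ℝ) - 2) / 2) • Ψ Φ' := by
    intro Φ'
    rw [hΨapp]
    refine Prod.ext ?_ rfl
    funext b
    change s ^ (((P.d : ℝ) - 2) / 2) * Φ'.1 ⟨b.src, b.dir⟩ = s ^ (((P.d : ℝ) - 2) / 2) * Φb Φ'.1 b
    exact congrArg (fun t => s ^ (((P.d : ℝ) - 2) / 2) * t) (hΦapp Φ'.1 ⟨b.src, b.dir⟩).symm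
  have hfin : Module.finrank ℝ (VecField P k × ScalarField P k N)
      = Fintype.card (PBond P k) + N * Fintype.card (Site P k) := by
    rw [Module.finrank_prod, Module.finrank_fintype_fun_eq_card, Module.finrank_pi_fintype, Finset.sum_const,
      Finset.card_univ, finrank_euclideanSpace_fin, smul_eq_mul, mul_comm]
  calc ∫ Φ' : VecField (P.scaleBy s hs) k × ScalarField (P.scaleBy s hs) k N,
          F (rescaleVec hs Φ'.1, rescaleScalar hs Φ'.2)
      = ∫ Φ' : VecField (P.scaleBy s hs) k × ScalarField (P.scaleBy s hs) k N,
          (fun Φ : VecField P k × ScalarField P k N => F (s ^ (((P.d : ℝ) - 2) / 2) • Φ)) (Ψ Φ') := by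
            simp_rw [hR]
    _ = ∫ Φ : VecField P k × ScalarField P k N, F (s ^ (((P.d : ℝ) - 2) / 2) • Φ) :=
          hΨmp.integral_comp' (fun Φ : VecField P k × ScalarField P k N => F (s ^ (((P.d : ℝ) - 2) / 2) • Φ))
    _ = |((s ^ (((P.d : ℝ) - 2) / 2)) ^ (Fintype.card (PBond P k) + N * Fintype.card (Site P k)))⁻¹|
          * ∫ Φ : VecField P k × ScalarField P k N, F Φ := by
          haveI := Measure.prod.instIsAddHaarMeasure (volume : Measure (VecField P k))
            (volume : Measure (ScalarField P k N))
          rw [Measure.volume_eq_prod, Measure.integral_comp_smul, hfin, smul_eq_mul]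

/-- **The partition function (1.10) under the rescaling of p. 607**: with `σ = s^{(d−2)/2}`,
`Z^{sε}_{e_s,λ_s,m₀²s⁻²,μ₀²s⁻²,E} = σ^{−(|bonds of T^{(k)}| + N·|T^{(k)}|)} · Z^ε_{e,λ,m₀²,μ₀²,E}` — the action is invariant
(`action_rescale`, the p. 607 claim) and the Lebesgue measure acquires the Jacobian (`integral_comp_rescale`); these are
the *"constant factors"* dropped in II (2.1) p. 556 / kept as *"const"* in (3.7) p. 613. PROVED. [cite: Balaban1982Higgs1, (1.10) p.605] -/
theorem partitionFn_rescale (hs : 0 < s) (C : ChargeData N) (c : Couplings) :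
    partitionFn (P.scaleBy s hs) k N (C.scaleBy P.d s) (c.scaleBy P.d s)
      = |((s ^ (((P.d : ℝ) - 2) / 2)) ^ (Fintype.card (PBond P k) + N * Fintype.card (Site P k)))⁻¹|
          * partitionFn P k N C c := by
  unfold partitionFn
  rw [← integral_comp_rescale hs (fun Φ : VecField P k × ScalarField P k N => Real.exp (-action C c Φ.1 Φ.2))]
  simp only [action_rescale]

end Jacobian

end Literature.MathematicalPhysics.QuantumFieldTheory.Balaban1983to89.HiggsRescaling
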